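import Mathlib
import Summits.Ventures.PercRepro2.TypedOBClass
import Summits.Ventures.PercRepro2.TypedTwoEdgesAtOClasses
import Summits.Ventures.PercRepro2.TypedBasesStarMarks

/-!
# Every class of the `o`-star `{o–u, o–b}` of the symmetrised kernel from the two-copy rows and row
2′TRI on the deletions (blind cell PercRepro2, night-3 g16, 2026-08-27; NIGHT3-CERT.md §25.7–25.8)

For `e = {o, u}`, `f = {o, b}` typed of type `1` at a mark `o` whose other edges are pinned closed,
the nine classes of the star `{e, f}` of `symKer K₃` (the (TRI-o) / (TRI-oM) objects of
TypedBasesStar.lean) are: the three same-colour classes, each `D₂ / 3`, and the six mixed classes,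
each `(N_τ(F ∖ e) + N_τ(F ∖ f)) / 3` (`two_edges_pieces`: the six mixed raw terms are additive
and the single attachments sum to the deletion counts).  Hence
**`omStar_classes_nonneg_of_rows`**: under `CrossCount a₁ a₂ b a₃`, `SameCount a₂ a₁ b a₃`, their
root mirrors, and row 2′TRI at the two deletions, every class sum
`typedClassCount F z τ {e, f} x₀ y₀ w₀ (symKer K₃)` is nonnegative — the (TRI-oM)-type statement at a
mark `o` of typed degree two with an edge to `b`, conditional on the open rows.  Own work; standard
axioms.
-/

namespace Summit.Ventures.PercRepro2

namespace CovForm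

namespace TypedRed

open OneTyped TypedA3

section Pieces

open Classical

variable {V : Type*} {E : Type*} [Fintype E] [DecidableEq E] {R : Type*} [Field R]

variable (ends : E → Sym2 V) (o a₁ a₂ a₃ b : V)

/-- The six mixed terms are additive and the single attachments sum to the deletion counts
(the local identities of the proof of `typedCount_two_edges_at_o`, restated). -/
theorem two_edges_pieces {e f : E} {u v : V} (he : ends e = s(o, u))
    (hf : ends f = s(o, v)) (hou : o ≠ u) (hov : o ≠ v) (hef : e ≠ f) (ho1 : o ≠ a₁) (ho2 : o ≠ a₂)
    (ho3 : o ≠ a₃) (hob : o ≠ b) (F : Finset E) (heF : e ∈ F) (hfF : f ∈ F) (z : Config E)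
    (τ : E → ℕ) (hτe : τ e = 1) (hτf : τ f = 1)
    (hcl : ∀ e', e' ≠ e → e' ≠ f → o ∈ ends e' → e' ∉ F ∧ z e' = false) :
    let K : Config E → Config E → Config E → R := K3 ends o a₁ a₂ a₃ b
    (term F z τ e f K true false false true false false =
        term F z τ e f K true false false false false false +
          term F z τ e f K false false false true false false) ∧
    (term F z τ e f K true false false false false true =
        term F z τ e f K true false false false false false +
          term F z τ e f K false false false false false true) ∧
    (term F z τ e f K false true true false false false =
        term F z τ e f K false false true false false false +
          term F z τ e f K false true false false false false) ∧
    (term F z τ e f K false false true false false true =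
        term F z τ e f K false false true false false false +
          term F z τ e f K false false false false false true) ∧
    (term F z τ e f K false true false false true false =
        term F z τ e f K false false false false true false +
          term F z τ e f K false true false false false false) ∧
    (term F z τ e f K false false false true true false =
        term F z τ e f K false false false false true false +
          term F z τ e f K false false false true false false) ∧
    (typedCount (F.erase f) (Function.update z f false) τ K =
        term F z τ e f K true false false false false false +
          term F z τ e f K false false true false false false +
          term F z τ e f K false false false false true false) ∧
    (typedCount (F.erase e) (Function.update z e false) τ K =
        term F z τ e f K false true false false false false +
          term F z τ e f K false false false true false false +
          term F z τ e f K false false false false false true) := by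
  intro K
  have hfe : f ∈ F.erase e := Finset.mem_erase.2 ⟨hef.symm, hfF⟩
  have hef' : e ∈ F.erase f := Finset.mem_erase.2 ⟨hef, heF⟩
  -- the six mixed colourings are additive
  have hm12 : term F z τ e f K true false false true false false =
      term F z τ e f K true false false false false false +
        term F z τ e f K false false false true false false := by
    unfold term
    rw [← typedCount_add]
    refine typedCount_congr_K_on _ _ _ fun x y w hxyw _ => ?_
    exact K3_mixed12 ends o a₁ a₂ a₃ b he hf hou hov hef ho1 ho2 ho3 hob
      (support_closed ends o F z hcl hef x fun e' he' => (hxyw e' he').1).1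
      (support_closed ends o F z hcl hef y fun e' he' => (hxyw e' he').2.1).1
      (support_closed ends o F z hcl hef w fun e' he' => (hxyw e' he').2.2).1
  have hm13 : term F z τ e f K true false false false false true =
      term F z τ e f K true false false false false false +
        term F z τ e f K false false false false false true := by
    unfold term
    rw [← typedCount_add]
    refine typedCount_congr_K_on _ _ _ fun x y w hxyw _ => ?_
    exact K3_mixed13 ends o a₁ a₂ a₃ b he hf hou hov hef ho1 ho2 ho3 hob
      (support_closed ends o F z hcl hef x fun e' he' => (hxyw e' he').1).1
      (support_closed ends o F z hcl hef y fun e' he' => (hxyw e' he').2.1).1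
      (support_closed ends o F z hcl hef w fun e' he' => (hxyw e' he').2.2).1
  have hm21 : term F z τ e f K false true true false false false =
      term F z τ e f K false false true false false false +
        term F z τ e f K false true false false false false := by
    unfold term
    rw [← typedCount_add]
    refine typedCount_congr_K_on _ _ _ fun x y w hxyw _ => ?_
    exact K3_mixed21 ends o a₁ a₂ a₃ b he hf hou hov hef ho1 ho2 ho3 hob
      (support_closed ends o F z hcl hef x fun e' he' => (hxyw e' he').1).1
      (support_closed ends o F z hcl hef y fun e' he' => (hxyw e' he').2.1).1
      (support_closed ends o F z hcl hef w fun e' he' => (hxyw e' he').2.2).1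
  have hm23 : term F z τ e f K false false true false false true =
      term F z τ e f K false false true false false false +
        term F z τ e f K false false false false false true := by
    unfold term
    rw [← typedCount_add]
    refine typedCount_congr_K_on _ _ _ fun x y w hxyw _ => ?_
    exact K3_mixed23 ends o a₁ a₂ a₃ b he hf hou hov hef ho1 ho2 ho3 hob
      (support_closed ends o F z hcl hef x fun e' he' => (hxyw e' he').1).1
      (support_closed ends o F z hcl hef y fun e' he' => (hxyw e' he').2.1).1
      (support_closed ends o F z hcl hef w fun e' he' => (hxyw e' he').2.2).1
  have hm31 : term F z τ e f K false true false false true false =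
      term F z τ e f K false false false false true false +
        term F z τ e f K false true false false false false := by
    unfold term
    rw [← typedCount_add]
    refine typedCount_congr_K_on _ _ _ fun x y w hxyw _ => ?_
    exact K3_mixed31 ends o a₁ a₂ a₃ b he hf hou hov hef ho1 ho2 ho3 hob
      (support_closed ends o F z hcl hef x fun e' he' => (hxyw e' he').1).1
      (support_closed ends o F z hcl hef y fun e' he' => (hxyw e' he').2.1).1
      (support_closed ends o F z hcl hef w fun e' he' => (hxyw e' he').2.2).1
  have hm32 : term F z τ e f K false false false true true false =
      term F z τ e f K false false false false true false +
        term F z τ e f K false false false true false false := by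
    unfold term
    rw [← typedCount_add]
    refine typedCount_congr_K_on _ _ _ fun x y w hxyw _ => ?_
    exact K3_mixed32 ends o a₁ a₂ a₃ b he hf hou hov hef ho1 ho2 ho3 hob
      (support_closed ends o F z hcl hef x fun e' he' => (hxyw e' he').1).1
      (support_closed ends o F z hcl hef y fun e' he' => (hxyw e' he').2.1).1
      (support_closed ends o F z hcl hef w fun e' he' => (hxyw e' he').2.2).1
  -- the single attachments, as counts of the kernel re-opened at one edge only
  have s1 : term F z τ e f K true false false false false false =
      typedCount ((F.erase e).erase f) (Function.update (Function.update z e false) f false) τ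
        (fun x y w => K (Function.update x e true) (Function.update y e false)
          (Function.update w e false)) := by
    unfold term
    refine typedCount_congr_K_on _ _ _ fun x y w hxyw _ => ?_
    have hx := (support_closed ends o F z hcl hef x fun e' he' => (hxyw e' he').1).2.2
    have hy := (support_closed ends o F z hcl hef y fun e' he' => (hxyw e' he').2.1).2.2
    have hw := (support_closed ends o F z hcl hef w fun e' he' => (hxyw e' he').2.2).2.2
    have hx' : Function.update x f false = x := Function.update_eq_self_iff.2 hx.symm
    have hy' : Function.update y f false = y := Function.update_eq_self_iff.2 hy.symm
    have hw' : Function.update w f false = w := Function.update_eq_self_iff.2 hw.symm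
    simp only [upd2, hx', hy', hw']
  have s2 : term F z τ e f K false false true false false false =
      typedCount ((F.erase e).erase f) (Function.update (Function.update z e false) f false) τ
        (fun x y w => K (Function.update x e false) (Function.update y e true)
          (Function.update w e false)) := by
    unfold term
    refine typedCount_congr_K_on _ _ _ fun x y w hxyw _ => ?_
    have hx := (support_closed ends o F z hcl hef x fun e' he' => (hxyw e' he').1).2.2
    have hy := (support_closed ends o F z hcl hef y fun e' he' => (hxyw e' he').2.1).2.2
    have hw := (support_closed ends o F z hcl hef w fun e' he' => (hxyw e' he').2.2).2.2
    have hx' : Function.update x f false = x := Function.update_eq_self_iff.2 hx.symm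
    have hy' : Function.update y f false = y := Function.update_eq_self_iff.2 hy.symm
    have hw' : Function.update w f false = w := Function.update_eq_self_iff.2 hw.symm
    simp only [upd2, hx', hy', hw']
  have s3 : term F z τ e f K false false false false true false =
      typedCount ((F.erase e).erase f) (Function.update (Function.update z e false) f false) τ
        (fun x y w => K (Function.update x e false) (Function.update y e false)
          (Function.update w e true)) := by
    unfold term
    refine typedCount_congr_K_on _ _ _ fun x y w hxyw _ => ?_
    have hx := (support_closed ends o F z hcl hef x fun e' he' => (hxyw e' he').1).2.2
    have hy := (support_closed ends o F z hcl hef y fun e' he' => (hxyw e' he').2.1).2.2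
    have hw := (support_closed ends o F z hcl hef w fun e' he' => (hxyw e' he').2.2).2.2
    have hx' : Function.update x f false = x := Function.update_eq_self_iff.2 hx.symm
    have hy' : Function.update y f false = y := Function.update_eq_self_iff.2 hy.symm
    have hw' : Function.update w f false = w := Function.update_eq_self_iff.2 hw.symm
    simp only [upd2, hx', hy', hw']
  have hxe : ∀ (x : Config E) (p : Bool), x e = false → Function.update x f p e = false :=
    fun x p hx => by rw [Function.update_of_ne hef]; exact hx
  have t1 : term F z τ e f K false true false false false false =
      typedCount ((F.erase e).erase f) (Function.update (Function.update z e false) f false) τ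
        (fun x y w => K (Function.update x f true) (Function.update y f false)
          (Function.update w f false)) := by
    unfold term
    refine typedCount_congr_K_on _ _ _ fun x y w hxyw _ => ?_
    have hx := (support_closed ends o F z hcl hef x fun e' he' => (hxyw e' he').1).2.1
    have hy := (support_closed ends o F z hcl hef y fun e' he' => (hxyw e' he').2.1).2.1
    have hw := (support_closed ends o F z hcl hef w fun e' he' => (hxyw e' he').2.2).2.1
    have hx' : Function.update (Function.update x f true) e false = Function.update x f true :=
      Function.update_eq_self_iff.2 (hxe x _ hx).symm
    have hy' : Function.update (Function.update y f false) e false = Function.update y f false :=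
      Function.update_eq_self_iff.2 (hxe y _ hy).symm
    have hw' : Function.update (Function.update w f false) e false = Function.update w f false :=
      Function.update_eq_self_iff.2 (hxe w _ hw).symm
    simp only [upd2, hx', hy', hw']
  have t2 : term F z τ e f K false false false true false false =
      typedCount ((F.erase e).erase f) (Function.update (Function.update z e false) f false) τ
        (fun x y w => K (Function.update x f false) (Function.update y f true)
          (Function.update w f false)) := by
    unfold term
    refine typedCount_congr_K_on _ _ _ fun x y w hxyw _ => ?_
    have hx := (support_closed ends o F z hcl hef x fun e' he' => (hxyw e' he').1).2.1
    have hy := (support_closed ends o F z hcl hef y fun e' he' => (hxyw e' he').2.1).2.1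
    have hw := (support_closed ends o F z hcl hef w fun e' he' => (hxyw e' he').2.2).2.1
    have hx' : Function.update (Function.update x f false) e false = Function.update x f false :=
      Function.update_eq_self_iff.2 (hxe x _ hx).symm
    have hy' : Function.update (Function.update y f true) e false = Function.update y f true :=
      Function.update_eq_self_iff.2 (hxe y _ hy).symm
    have hw' : Function.update (Function.update w f false) e false = Function.update w f false :=
      Function.update_eq_self_iff.2 (hxe w _ hw).symm
    simp only [upd2, hx', hy', hw']
  have t3 : term F z τ e f K false false false false false true =
      typedCount ((F.erase e).erase f) (Function.update (Function.update z e false) f false) τ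
        (fun x y w => K (Function.update x f false) (Function.update y f false)
          (Function.update w f true)) := by
    unfold term
    refine typedCount_congr_K_on _ _ _ fun x y w hxyw _ => ?_
    have hx := (support_closed ends o F z hcl hef x fun e' he' => (hxyw e' he').1).2.1
    have hy := (support_closed ends o F z hcl hef y fun e' he' => (hxyw e' he').2.1).2.1
    have hw := (support_closed ends o F z hcl hef w fun e' he' => (hxyw e' he').2.2).2.1
    have hx' : Function.update (Function.update x f false) e false = Function.update x f false :=
      Function.update_eq_self_iff.2 (hxe x _ hx).symm
    have hy' : Function.update (Function.update y f false) e false = Function.update y f false :=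
      Function.update_eq_self_iff.2 (hxe y _ hy).symm
    have hw' : Function.update (Function.update w f true) e false = Function.update w f true :=
      Function.update_eq_self_iff.2 (hxe w _ hw).symm
    simp only [upd2, hx', hy', hw']
  -- the single attachments of `e` (f pinned closed) sum to the count with `f` deleted
  have hE : typedCount (F.erase f) (Function.update z f false) τ K =
      term F z τ e f K true false false false false false +
        term F z τ e f K false false true false false false +
        term F z τ e f K false false false false true false := by
    rw [typedCount_split (F.erase f) e hef', hτe, sum_bool3_one, Finset.erase_right_comm,
      Function.update_comm hef.symm, s1, s2, s3]
  -- the single attachments of `f` (e pinned closed) sum to the count with `e` deleted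
  have hF : typedCount (F.erase e) (Function.update z e false) τ K =
      term F z τ e f K false true false false false false +
        term F z τ e f K false false false true false false +
        term F z τ e f K false false false false false true := by
    rw [typedCount_split (F.erase e) f hfe, hτf, sum_bool3_one, t1, t2, t3]
  exact ⟨hm12, hm13, hm21, hm23, hm31, hm32, hE, hF⟩


end Pieces

section Classes

open Classical

variable {V : Type*} {E : Type*} [Fintype E] [DecidableEq E] {R : Type*} [Field R] [LinearOrder R]
  [IsStrictOrderedRing R]

variable (ends : E → Sym2 V) (o a₁ a₂ a₃ b : V)

omit [LinearOrder R] [IsStrictOrderedRing R] in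
/-- A class of the star `{e, f}` (types `1, 1`) depends only on the six bits of the colouring at
`e` and `f`, through `term`; it vanishes unless exactly one copy is open at `e` and at `f`. -/
lemma class_eq_term (F : Finset E) (e f : E) (he : e ∈ F) (hf : f ∈ F) (hef : e ≠ f)
    (z : Config E) (τ : E → ℕ) (hτe : τ e = 1) (hτf : τ f = 1) (x₀ y₀ w₀ : Config E)
    (K : Config E → Config E → Config E → R) :
    typedClassCount F z τ {e, f} x₀ y₀ w₀ K =
      if (x₀ e).toNat + (y₀ e).toNat + (w₀ e).toNat = 1 ∧
          (x₀ f).toNat + (y₀ f).toNat + (w₀ f).toNat = 1 then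
        term F z τ e f K (x₀ e) (x₀ f) (y₀ e) (y₀ f) (w₀ e) (w₀ f)
      else 0 := by
  rw [typedClassCount_pair_eq F e f he hf hef, hτe, hτf]
  rfl

/-- **Every class of the `o`-star `{o–u, o–b}` of the symmetrised kernel is nonnegative under the
two-copy rows and row 2′TRI at the two deletions.** -/
theorem omStar_classes_nonneg_of_rows {e f : E} {u : V} (he : ends e = s(o, u))
    (hf : ends f = s(o, b)) (hou : o ≠ u) (hef : e ≠ f) (ho1 : o ≠ a₁) (ho2 : o ≠ a₂) (ho3 : o ≠ a₃)
    (hob : o ≠ b) (F : Finset E) (heF : e ∈ F) (hfF : f ∈ F) (z : Config E) (τ : E → ℕ)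
    (hτ : ∀ e' ∈ F, τ e' = 1 ∨ τ e' = 2) (hτe : τ e = 1) (hτf : τ f = 1)
    (hcl : ∀ e', e' ≠ e → e' ≠ f → o ∈ ends e' → e' ∉ F ∧ z e' = false)
    (hC : CrossCount R ends a₁ a₂ b a₃) (hS : SameCount (R := R) ends a₂ a₁ b a₃)
    (hCm : CrossCount R ends a₂ a₁ b a₃) (hSm : SameCount (R := R) ends a₁ a₂ b a₃)
    (hNe : 0 ≤ typedCount (F.erase e) (Function.update z e false) τ
      (K3 ends o a₁ a₂ a₃ b : Config E → Config E → Config E → R))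
    (hNf : 0 ≤ typedCount (F.erase f) (Function.update z f false) τ
      (K3 ends o a₁ a₂ a₃ b : Config E → Config E → Config E → R))
    (x₀ y₀ w₀ : Config E) :
    0 ≤ typedClassCount F z τ {e, f} x₀ y₀ w₀
      (symKer (K3 ends o a₁ a₂ a₃ b : Config E → Config E → Config E → R)) := by
  have hD : 0 ≤ doubleClass F z τ e f (K3 ends o a₁ a₂ a₃ b : Config E → Config E → Config E → R) :=
    doubleClass_ob_nonneg_of_rows ends o a₁ a₂ a₃ b he hf hou hef ho1 ho2 ho3 hob F z τ hτ hcl hC hS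
      hCm hSm
  obtain ⟨m12, m13, m21, m23, m31, m32, hE, hF⟩ := two_edges_pieces (R := R) ends o a₁ a₂ a₃ b he hf
    hou hob hef ho1 ho2 ho3 hob F heF hfF z τ hτe hτf hcl
  set K : Config E → Config E → Config E → R := K3 ends o a₁ a₂ a₃ b with hK
  unfold doubleClass at hD
  rw [typedClassCount_symKer, class_eq_term F e f heF hfF hef z τ hτe hτf,
    class_eq_term F e f heF hfF hef z τ hτe hτf, class_eq_term F e f heF hfF hef z τ hτe hτf,
    class_eq_term F e f heF hfF hef z τ hτe hτf, class_eq_term F e f heF hfF hef z τ hτe hτf,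
    class_eq_term F e f heF hfF hef z τ hτe hτf]
  -- the six permuted conditions are the same condition
  have hc1 : ((x₀ e).toNat + (w₀ e).toNat + (y₀ e).toNat = 1 ∧
      (x₀ f).toNat + (w₀ f).toNat + (y₀ f).toNat = 1) ↔
      ((x₀ e).toNat + (y₀ e).toNat + (w₀ e).toNat = 1 ∧
      (x₀ f).toNat + (y₀ f).toNat + (w₀ f).toNat = 1) := by constructor <;> rintro ⟨h1, h2⟩ <;>
        exact ⟨by omega, by omega⟩
  have hc2 : ((y₀ e).toNat + (x₀ e).toNat + (w₀ e).toNat = 1 ∧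
      (y₀ f).toNat + (x₀ f).toNat + (w₀ f).toNat = 1) ↔
      ((x₀ e).toNat + (y₀ e).toNat + (w₀ e).toNat = 1 ∧
      (x₀ f).toNat + (y₀ f).toNat + (w₀ f).toNat = 1) := by constructor <;> rintro ⟨h1, h2⟩ <;>
        exact ⟨by omega, by omega⟩
  have hc3 : ((y₀ e).toNat + (w₀ e).toNat + (x₀ e).toNat = 1 ∧
      (y₀ f).toNat + (w₀ f).toNat + (x₀ f).toNat = 1) ↔
      ((x₀ e).toNat + (y₀ e).toNat + (w₀ e).toNat = 1 ∧
      (x₀ f).toNat + (y₀ f).toNat + (w₀ f).toNat = 1) := by constructor <;> rintro ⟨h1, h2⟩ <;>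
        exact ⟨by omega, by omega⟩
  have hc4 : ((w₀ e).toNat + (x₀ e).toNat + (y₀ e).toNat = 1 ∧
      (w₀ f).toNat + (x₀ f).toNat + (y₀ f).toNat = 1) ↔
      ((x₀ e).toNat + (y₀ e).toNat + (w₀ e).toNat = 1 ∧
      (x₀ f).toNat + (y₀ f).toNat + (w₀ f).toNat = 1) := by constructor <;> rintro ⟨h1, h2⟩ <;>
        exact ⟨by omega, by omega⟩
  have hc5 : ((w₀ e).toNat + (y₀ e).toNat + (x₀ e).toNat = 1 ∧
      (w₀ f).toNat + (y₀ f).toNat + (x₀ f).toNat = 1) ↔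
      ((x₀ e).toNat + (y₀ e).toNat + (w₀ e).toNat = 1 ∧
      (x₀ f).toNat + (y₀ f).toNat + (w₀ f).toNat = 1) := by constructor <;> rintro ⟨h1, h2⟩ <;>
        exact ⟨by omega, by omega⟩
  simp only [hc1, hc2, hc3, hc4, hc5]
  by_cases hc : (x₀ e).toNat + (y₀ e).toNat + (w₀ e).toNat = 1 ∧
      (x₀ f).toNat + (y₀ f).toNat + (w₀ f).toNat = 1
  · simp only [hc]
    -- the nine admissible colourings
    have key : ∀ (a b c a' b' c' : Bool), a.toNat + b.toNat + c.toNat = 1 →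
        a'.toNat + b'.toNat + c'.toNat = 1 →
        0 ≤ (6 : R)⁻¹ * (term F z τ e f K a a' b b' c c' + term F z τ e f K a a' c c' b b' +
          term F z τ e f K b b' a a' c c' + term F z τ e f K b b' c c' a a' +
          term F z τ e f K c c' a a' b b' + term F z τ e f K c c' b b' a a') := by
      intro a b c a' b' c' h1 h2
      refine mul_nonneg (by norm_num) ?_
      cases a <;> cases b <;> cases c <;> simp only [Bool.toNat_true, Bool.toNat_false] at h1 <;>
        try omega
      all_goals cases a' <;> cases b' <;> cases c' <;>
        simp only [Bool.toNat_true, Bool.toNat_false] at h2 <;> try omega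
      all_goals linarith
    exact key _ _ _ _ _ _ hc.1 hc.2
  · simp only [hc, if_false]
    norm_num

/-- **The (TRI-oM) classes at an instance whose `o`–mark star is `{o–a₁, o–b}`** (the typer's
`TriOM.markStar`, TypedBasesStarMarks.lean): under the rows and row 2′TRI at the two deletions,
every class sum of `symKer K₃` over the colourings of that star is nonnegative — the instance-level
content of `TriOM.TypedBasesOM` at a mark `o` of typed degree two attached to `a₁` and `b`. -/
theorem typedBasesOM_classes_of_rows {e f : E} (he : ends e = s(o, a₁)) (hf : ends f = s(o, b))
    (hef : e ≠ f) (ho1 : o ≠ a₁) (ho2 : o ≠ a₂) (ho3 : o ≠ a₃) (hob : o ≠ b) (F : Finset E)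
    (heF : e ∈ F) (hfF : f ∈ F) (z : Config E) (τ : E → ℕ) (hτ : ∀ e' ∈ F, τ e' = 1 ∨ τ e' = 2)
    (hτe : τ e = 1) (hτf : τ f = 1)
    (hcl : ∀ e', e' ≠ e → e' ≠ f → o ∈ ends e' → e' ∉ F ∧ z e' = false)
    (hstar : TriOM.markStar ends o a₁ a₂ a₃ b F = {e, f})
    (hC : CrossCount R ends a₁ a₂ b a₃) (hS : SameCount (R := R) ends a₂ a₁ b a₃)
    (hCm : CrossCount R ends a₂ a₁ b a₃) (hSm : SameCount (R := R) ends a₁ a₂ b a₃)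
    (hNe : 0 ≤ typedCount (F.erase e) (Function.update z e false) τ
      (K3 ends o a₁ a₂ a₃ b : Config E → Config E → Config E → R))
    (hNf : 0 ≤ typedCount (F.erase f) (Function.update z f false) τ
      (K3 ends o a₁ a₂ a₃ b : Config E → Config E → Config E → R))
    (x₀ y₀ w₀ : Config E) :
    0 ≤ typedClassCount F z τ (TriOM.markStar ends o a₁ a₂ a₃ b F) x₀ y₀ w₀
      (symKer (K3 ends o a₁ a₂ a₃ b : Config E → Config E → Config E → R)) := by
  rw [hstar]
  exact omStar_classes_nonneg_of_rows ends o a₁ a₂ a₃ b he hf ho1 hef ho1 ho2 ho3 hob F heF hfF z τ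
    hτ hτe hτf hcl hC hS hCm hSm hNe hNf x₀ y₀ w₀

end Classes

end TypedRed

end CovForm

end Summit.Ventures.PercRepro2
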